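import Mathlib
import Literature.MathematicalPhysics.MHD.BallooningSAlphaMasterPhase
import Literature.MathematicalPhysics.MHD.BallooningSAlphaFirstRegionSqrt
import HarnessLib

/-!
# THE FIRST BOUNDARY OF THE `s–α` MODEL LEAVES THE ORIGIN WITH SLOPE AT LEAST `1/2`: every `(s, α)` with
# `4α²(1 + s) ≤ s²` — i.e. `s ≤ −1`, or `|α| ≤ |s|/(2√(1 + s))` — is on the stable side (master phase with `b` at the vertex and `n = −αu sin θ`);
# hence `s/(2√(1+s)) ≤ α₁(s)` (`s ≥ 3/5`), `StableSide 1 α` for `α ≤ 7/20`, and the negative-shear strip `−1 < s < 0` is stable for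
# `|α| ≤ |s|/(2√(1+s))` (→ every `α` as `s → −1⁺`)  (Freidberg, *Ideal MHD* (12.100) «`α = Ks` where `K ≈ 0.6` … valid over most of the
# plasma except near the origin»; Fundamenski (4.162) `α/s ≈ 0.6`)

Topic `Literature/MathematicalPhysics/MHD` (namespace = path; sub-namespace `Ballooning.SAlpha`).  Written for the venture ladder GRIDFUSION,
rung F3, by gridfusion-lit-3 (g15), 2026-08-28, over `BallooningSAlphaMasterPhase.lean` (`stableSide_of_masterPhase`: the residual of
`(Λ(α cos θ + b) + n)/(1 + Λ²)` is `α(1 + s + b) cos θ + b(s + b) + n′ + n² − (α cos θ + b − Λn)²/(1 + Λ²)`) and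
`BallooningSAlphaFirstRegionSqrt.lean` / `…FirstCriticalGradient.lean` (`firstCritical`) BY IMPORT.  0 named facts, 0 kit, no `decide`.

## What is PROVED (everything; 0 facts)
* §1 ★★★ `stableSide_of_sq_le` — for every real `s, α` with `4α²(1 + s) ≤ s²`: `StableSide s α` (ONE polynomial criterion that
  contains the half-plane `s ≤ −1` of `BallooningSAlphaShearlessStable.lean` and, for `s > −1`, the region `|α| ≤ |s|/(2√(1+s))`).  Mechanism: take
  `n = −αu sin θ` so that `n′ = −αu cos θ` CANCELS the curvature term `αu cos θ` (`u = 1 + s + b`); the residual is then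
  `b(s + b) + α²u² sin²θ − (…)²/(1 + Λ²) ≤ (1 + α²)u² − (2 + s)u + (1 + s)`, minimised at `u = (2 + s)/(2(1 + α²))` with value
  `(1 + s) − (2 + s)²/(4(1 + α²)) ≤ 0 ⟺ 4α²(1 + s) ≤ s²`.
* §2 user forms: ★★★ `stableSide_of_two_mul_sqrt_le` (`s ≥ 0`, `0 ≤ α`, `2α√(1+s) ≤ s`); ★★ `stableSide_negStrip` (`−1 < s`,
  `2|α|√(1+s) ≤ −s`, so `s ≤ 0`: the strip `−1 < s < 0` up to a bound that blows up as `s → −1⁺`); `stableSide_one_of_le_seven_twentieths`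
  (`StableSide 1 α` for `0 ≤ α ≤ 7/20`; was `17/100`), `stableSide_half_unit` (`StableSide (−1/2) α` for `|α| ≤ 7/20`).
* §3 ★★★ `half_div_sqrt_le_firstCritical` — `s/(2√(1+s)) ≤ α₁(s)` for every `s ≥ 3/5` (better than `(√(1+s) − 1)²` for `s < 2.18…`):
  the certified slope of the first boundary at moderate shear is `≥ 1/(2√(1+s))` — `≥ 0.35` at `s = 1`, `→ 1/2` as `s → 0`.
THREE COLUMNS.  CERTIFIED: the region `{4α²(1+s) ≤ s²}` of the MODEL's plane is on the stable side (one-surface Newcomb sense).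
VALIDATED: float `α₁(s)/s = 1.13, 0.94, 0.78, 0.61` at `s = 0.3, 0.375, 0.5, 1` (edge3.py) vs certified `1/(2√(1+s)) = 0.44, 0.43, 0.41,
0.35`; Fig. 12.5 / (12.100) `K ≈ 0.6`.  NOT CLAIMED: the slope `0.6`; the strip `−1 < s < 0` for larger `|α|`.

## Sources
* J. P. Freidberg, *Ideal MHD*, CUP 2014 [Freidberg2014] §12.6.2 eqs. (12.97)–(12.100), p0533 L11 [corpus: book:freidbergnd-ideal-mhd p0532–p0533].
* W. Fundamenski, *Power Exhaust in Fusion Plasmas*, CUP 2009 [Fundamenski2009] §4.2.4 (4.160)–(4.162) [corpus: p0170 L33–L37, p0171 L3–L5].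
* P. Hartman, *ODE*, SIAM 2002 [Hartman2002] Ch. XI §6 Thm. 6.2 — via `BallooningSAlphaMasterPhase.lean`.
-/

noncomputable section

open Real Set Filter

namespace Literature.MathematicalPhysics.MHD

namespace Ballooning

namespace SAlpha

/-! ## §1 The vertex phase -/

/-- ★★★ THE POLYNOMIAL CRITERION: every real `(s, α)` with `4α²(1 + s) ≤ s²` is on the stable side — no window of the `s–α`
model carries an instability witness (`s ≤ −1`: every `α`; `s > −1`: `|α| ≤ |s|/(2√(1+s))`) — master phase with `b = (2 + s)/(2(1 + α²)) − 1 − s` and `n = −α(1 + s + b) sin θ`.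
[cite: Freidberg2014, §12.6.2 eqs. (12.97)–(12.100)] with [Hartman2002] Ch. XI §6 Thm. 6.2 -/
theorem stableSide_of_sq_le {s α : ℝ} (h : 4 * α ^ 2 * (1 + s) ≤ s ^ 2) : StableSide s α := by
  -- the vertex `u = (2 + s)/(2(1 + α²))` and `b = u − 1 − s`
  have hα2 : 0 < 1 + α ^ 2 := by positivity
  obtain ⟨u, hu⟩ : ∃ u : ℝ, (2 + s) / (2 * (1 + α ^ 2)) = u := ⟨_, rfl⟩
  have hu2 : 2 * (1 + α ^ 2) * u = 2 + s := by
    rw [← hu]; field_simp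
  -- the key scalar inequality `(1+α²)u² − (2+s)u + (1+s) ≤ 0`
  have hkey : (1 + α ^ 2) * u ^ 2 - (2 + s) * u + (1 + s) ≤ 0 := by
    have e : 4 * (1 + α ^ 2) * ((1 + α ^ 2) * u ^ 2 - (2 + s) * u + (1 + s))
        = (2 * (1 + α ^ 2) * u) ^ 2 - 2 * (2 + s) * (2 * (1 + α ^ 2) * u) + 4 * (1 + α ^ 2) * (1 + s) := by ring
    rw [hu2] at e
    have hneg : 4 * (1 + α ^ 2) * ((1 + α ^ 2) * u ^ 2 - (2 + s) * u + (1 + s)) ≤ 0 := by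
      rw [e]; nlinarith [h]
    by_contra hx
    push Not at hx
    have := mul_pos (by positivity : (0 : ℝ) < 4 * (1 + α ^ 2)) hx
    linarith
  refine stableSide_of_masterPhase (b := u - 1 - s) (n := fun θ => -α * u * Real.sin θ) (n' := fun θ => -α * u * Real.cos θ)
    (fun θ => by simpa using ((Real.hasDerivAt_sin θ).const_mul (-α * u))) (by fun_prop) fun θ => ?_
  have hsq : 0 ≤ (α * Real.cos θ + (u - 1 - s) - shearParam s α θ * (-α * u * Real.sin θ)) ^ 2 / bending s α θ :=
    div_nonneg (sq_nonneg _) (bending_pos s α θ).le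
  have hsin : Real.sin θ ^ 2 ≤ 1 := Real.sin_sq_le_one θ
  have h1 : (-α * u * Real.sin θ) ^ 2 ≤ α ^ 2 * u ^ 2 := by
    have : (-α * u * Real.sin θ) ^ 2 = α ^ 2 * u ^ 2 * Real.sin θ ^ 2 := by ring
    rw [this]
    have h0 : 0 ≤ α ^ 2 * u ^ 2 := by positivity
    nlinarith
  have h2 : α * (1 + s + (u - 1 - s)) * Real.cos θ + -α * u * Real.cos θ = 0 := by ring
  have h3 : (u - 1 - s) * (s + (u - 1 - s)) + α ^ 2 * u ^ 2 = (1 + α ^ 2) * u ^ 2 - (2 + s) * u + (1 + s) := by ring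
  nlinarith [hsq, h1, h2, h3, hkey]

/-! ## §2 User forms -/

/-- ★★★ `s ≥ 0`, `0 ≤ α`, `2α√(1 + s) ≤ s` ⇒ `StableSide s α`: the first region of stability contains `{0 ≤ α ≤ s/(2√(1+s))}` — near the
origin the first boundary has slope at least `1/(2√(1+s)) → 1/2`. [cite: Freidberg2014, §12.6.2 eq. (12.100)] («`α = Ks`, `K ≈ 0.6`») with
[Fundamenski2009] §4.2.4 (4.162) -/
theorem stableSide_of_two_mul_sqrt_le {s α : ℝ} (hs : 0 ≤ s) (hα : 0 ≤ α) (h : 2 * α * Real.sqrt (1 + s) ≤ s) : StableSide s α := by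
  refine stableSide_of_sq_le ?_
  have hr : Real.sqrt (1 + s) ^ 2 = 1 + s := Real.sq_sqrt (by linarith)
  have h0 : 0 ≤ 2 * α * Real.sqrt (1 + s) := by positivity
  have h2 : (2 * α * Real.sqrt (1 + s)) ^ 2 ≤ s ^ 2 := pow_le_pow_left₀ h0 h 2
  nlinarith

/-- ★★ THE NEGATIVE-SHEAR STRIP: for `−1 < s` and `2|α|√(1 + s) ≤ −s` (so `s ≤ 0`), `StableSide s α` (the bound `|α| ≤ |s|/(2√(1+s))` grows
without limit as `s → −1⁺`, matching the whole-line result at `s ≤ −1`). [cite: Freidberg2014, §12.6.2 eqs. (12.97)–(12.99)] (p0532 L17–L18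
«shear … large and negative … stabilizing») with [Fundamenski2009] §4.2.4 (p0170 L33 «stability for `s < s₋(α)`») -/
theorem stableSide_negStrip {s α : ℝ} (hs : -1 < s) (h : 2 * |α| * Real.sqrt (1 + s) ≤ -s) : StableSide s α := by
  refine stableSide_of_sq_le ?_
  have hr : Real.sqrt (1 + s) ^ 2 = 1 + s := Real.sq_sqrt (by linarith)
  have h0 : 0 ≤ 2 * |α| * Real.sqrt (1 + s) := by positivity
  have h2 : (2 * |α| * Real.sqrt (1 + s)) ^ 2 ≤ (-s) ^ 2 := pow_le_pow_left₀ h0 h 2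
  have ha : |α| ^ 2 = α ^ 2 := sq_abs α
  nlinarith

/-- At unit shear every `0 ≤ α ≤ 7/20` is on the stable side (`4·(7/20)²·2 = 0.98 ≤ 1`; was `17/100`, float edge `0.61`).
[cite: Freidberg2014, §12.6.2 eq. (12.100)] -/
theorem stableSide_one_of_le_seven_twentieths {α : ℝ} (hα : 0 ≤ α) (h : α ≤ 7 / 20) : StableSide 1 α :=
  stableSide_of_sq_le (by nlinarith)

/-- At `s = −1/2` every `|α| ≤ 7/20` is on the stable side (`4·(7/20)²·(1/2) = 0.245 ≤ 1/4`). [cite: Freidberg2014, §12.6.2 eq. (12.97)] -/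
theorem stableSide_half_unit {α : ℝ} (h : |α| ≤ 7 / 20) : StableSide (-(1 / 2)) α := by
  refine stableSide_of_sq_le ?_
  have ha : |α| ^ 2 = α ^ 2 := sq_abs α
  have h0 : 0 ≤ |α| := abs_nonneg α
  nlinarith

/-! ## §3 The first critical gradient near the origin -/

/-- `s/(2√(1+s))` is first-stable (`s ≥ 0`). [cite: Freidberg2014, §12.6.2 eq. (12.100)] -/
theorem half_div_sqrt_mem_firstStableSet {s : ℝ} (hs : 0 ≤ s) : s / (2 * Real.sqrt (1 + s)) ∈ firstStableSet s := by
  have hr : 0 < Real.sqrt (1 + s) := Real.sqrt_pos.2 (by linarith)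
  refine ⟨by positivity, fun α' hα' => stableSide_of_two_mul_sqrt_le hs hα'.1 ?_⟩
  have := hα'.2
  rw [le_div_iff₀ (by positivity)] at this
  linarith

/-- ★★★ `s/(2√(1+s)) ≤ α₁(s) < s` for every `s ≥ 3/5`: the certified slope of the first boundary is at least `1/(2√(1+s))`
(`0.395` at `s = 3/5`, `0.354` at `s = 1`). [cite: Freidberg2014, §12.6.2 eq. (12.100)] with [Fundamenski2009] §4.2.4 (4.162) -/
theorem half_div_sqrt_le_firstCritical {s : ℝ} (hs : 3 / 5 ≤ s) :
    firstCritical s ∈ Ico (s / (2 * Real.sqrt (1 + s))) s :=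
  ⟨le_csSup (bddAbove_firstStableSet (by linarith) (not_stableSide_diag_all hs)) (half_div_sqrt_mem_firstStableSet (by linarith)),
    (firstCritical_mem_Ico hs).2⟩

/-- The combined lower error bar: `max (s/(2√(1+s))) ((√(1+s) − 1)²) ≤ α₁(s)` for `s ≥ 3/5`. [cite: Freidberg2014, §12.6.2 eq. (12.100)] -/
theorem max_le_firstCritical {s : ℝ} (hs : 3 / 5 ≤ s) :
    max (s / (2 * Real.sqrt (1 + s))) ((Real.sqrt (1 + s) - 1) ^ 2) ≤ firstCritical s :=
  max_le (half_div_sqrt_le_firstCritical hs).1 (sqrt_sub_one_sq_le_firstCritical hs).1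

end SAlpha

end Ballooning

end Literature.MathematicalPhysics.MHD

end
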